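import Summits.NavierStokesRegularity.NavierStokesRegularity.Theorems.WakeRatchetEternalViscousRate.Negative.EternalViscousRateFalseOfFineFixedSeedTodaPumps
import HarnessLib
import HarnessLib.Audit

/-!
# `WakeRatchet.TailRateRatchet` (stmt-NavierStokesRegularity-25584, the route's repaired deciding crux) — negative lemma modulo
# FINE-SCALE TODA PUMPS AT A FIXED SEED (`WakeRatchetCircuitPumpNoUniform.FineFixedSeedTodaPumps`)

`TailRateRatchet` is the parent of the dissipation split `EternalInviscidRate` (⟨25646⟩) / `EternalViscousRate` (⟨25647⟩) and implies
each child (the `ν̂ > 0` slice is `EternalViscousRate`: drop the sign hypothesis; tree: `WakeRatchetTailRatchetLive.eternalViscousRate_of_tailRateRatchet`, inlined in the proof to keep this file outside that module's import cone).  The companion Negative file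
`WakeRatchetEternalViscousRate/Negative/EternalViscousRateFalseOfFineFixedSeedTodaPumps` (p829025) refutes the viscous child modulo
the EXPLICIT construction item `FineFixedSeedTodaPumps` (exactly self-similar Type-I non-trivial solutions of the m = 2 seeded graded
Toda circuit `T_ε` at ONE fixed seed `ε ∈ (0,1]` and arbitrarily fine scale ratios — the fixed-seed continuation `lam ↓ 1` of the
tree's PROVED perpetual pump, stmt-1834).  Hence the parent is refuted modulo the same item:

* `TailRateRatchet_false_of_FineFixedSeedTodaPumps : FineFixedSeedTodaPumps → ¬ TailRateRatchet`.

Compared with the existing hold `WakeRatchetViscDSS.TailRateRatchet_false_of_ViscousBlockDSSWaves` (bare existence of a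
dissipation-balanced block-DSS profile on some fixed class) the hypothesis is a concrete two-mode ODE continuation problem.
OPEN (see the companion file for why it is not constructed); no verdict changes.
HONEST FRAMING: MODEL lattice ODEs only (Tao 2016 §4, §6.4); nothing here is a statement about the Navier–Stokes equations; no
summit statement is proved or refuted.
-/

noncomputable section

set_option linter.dupNamespace false

namespace Summit.NavierStokesRegularity.NavierStokesRegularity.Theorems

namespace WakeRatchetCircuitPumpNoUniform

/-- **Negative lemma: `FineFixedSeedTodaPumps → ¬ TailRateRatchet`** (the parent implies the viscous child, which the fixed-seed
pumps refute).  MODEL lattice only; no verdict changes.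
[cite: Tao2016AveragedNS, §4 Thm. 4.2 (statement shape), the viscous equation before it, §6.4; cell vocabulary (stmt-NavierStokesRegularity-25584)] -/
theorem TailRateRatchet_false_of_FineFixedSeedTodaPumps :
    FineFixedSeedTodaPumps →
      ¬ Summit.NavierStokesRegularity.NavierStokesRegularity.Theses.WakeRatchet.TailRateRatchet :=
  fun h hP => EternalViscousRate_false_of_FineFixedSeedTodaPumps h fun R hR => by
    -- the parent implies its viscous child: drop the hypothesis `0 < ν̂`
    -- (tree: `WakeRatchetTailRatchetLive.eternalViscousRate_of_tailRateRatchet`, inlined to stay outside that module's import cone)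
    obtain ⟨a, ha, εs, hεs, H⟩ := hP R hR
    exact ⟨a, ha, εs, hεs, fun ε₀ hε₀ hle α hα νh W _ hW hU => H ε₀ hε₀ hle α hα νh W hW hU⟩

end WakeRatchetCircuitPumpNoUniform

end Summit.NavierStokesRegularity.NavierStokesRegularity.Theorems

end
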